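import Summits.CriticalPhenomena.PercolationContinuityZ3.Theorems.Transplant.CubicLatticesScope
import Mathlib.Algebra.Ring.Int.Parity
import Mathlib.Algebra.Ring.Int.Units
import Mathlib.Tactic.FinCases
import HarnessLib

/-!
# Planar-skeleton data (Φ1) for the face-centred and body-centred cubic lattices: the two-coordinate skeleton maps onto `ℤ²`,
# the point group of signed coordinate permutations, `D₄`-equivariance, translation-equivariance, Lipschitz and fibre control

builds on p205010 (kernel theorem, internal audit signed; external expert review pending).
Status sentence (coordinator 2026-08-20T04:30Z): "θ(p_c) = 0 on ℤ^d, all d ≥ 2 — kernel-verified (Lean 4/Mathlib,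
standard axioms); internal adversarial audit SIGNED 2026-08-20 04:29Z; external expert review pending."

New lemmas of the lane (`prim-bschramm-*`, seat `prim-bschramm-stmt`; lead request 2026-08-20T06:15Z, `BLUEPRINT-I-PHI.md` §0/§3 "Φ-inst",
pattern of p4's Heisenberg file `PercNearOneGluingNoHeavySamePHeisenbergSkeleton.lean`).  The abstract datum `PlanarSkeleton G` (p4, interface
(I-Φ)) asks for: a map `φ : V → ℤ²` moving by sup-norm `≤ 1` along edges; graph automorphisms realising all translations of `ℤ²` and the dihedral
group `D₄` of signed coordinate permutations of `ℤ²`, `φ`-equivariantly; and thin fibres (input Φ2, companion file `CubicLatticesCylinder.lean`).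
For the lane's cubic lattices (`StatementCubicLattices.lean`: `fccGraph` on `D₃ = {x ∈ ℤ³ : Σ xᵢ even}`, edges `‖x−y‖² = 2`; `bccGraph` on
`2·D₃* = {all xᵢ even or all odd}`, edges `‖x−y‖² = 3`) this file PROVES:

* `distSqGraphSignedPermIso` — every signed coordinate permutation of `ℤ^d` (the tree's `Site.signedPerm π ε`, the hyperoctahedral point group)
  preserving a vertex set `S` is an automorphism of the distance graph `(distSqGraph d m).induce S`; `fccPointIso π ε`, `bccPointIso π ε` — all
  `48` elements of the cubic point group are automorphisms of the fcc and bcc lattices fixing the origin (`signedPerm_mem_fccSite_iff`,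
  `signedPerm_mem_bccSite_iff`: both vertex sets are invariant);
* the skeletons `fccSkel x = (x₀, x₁)` and `bccSkel x = ((x₀+x₁)/2, (x₀−x₁)/2)` (integral on bcc sites; the rotated frame makes EVERY translation
  of `ℤ²` a skeleton-translation and makes `bccSkel` a graph homomorphism onto `zdGraph 2`, `zdGraph_adj_bccSkel`), both SURJECTIVE onto `Site 2`,
  ADDITIVE (so the lattice translations `distSqGraphShiftIso` act on the skeleton by translations: `fccSkel_shiftIso`, `bccSkel_shiftIso`),
  `1`-Lipschitz for the sup-norm along edges (`fccSkel_lipschitz`, `bccSkel_lipschitz`), with FIBRE CONTROL `|x₂ − y₂| ≤ 1` along edges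
  (`fcc_abs_sub_fibre_le`, `bcc_abs_sub_fibre_le` — the cutset input of Φ2);
* (companion file `CubicLatticesPointGroupD4.lean`) `D₄`-equivariance for two generators of the stabiliser of the fibre axis: the swap
  `x₀ ↔ x₁` and the flip `x₀ ↦ −x₀` act on the skeleton by two reflections generating the dihedral group `D₄` of the square lattice.
[cite: ConwaySloane1999, Ch. 4 §7.1 (D_n and its automorphisms: all permutations and sign changes)] [cite: KozmaNitzan2024, §4 Lemma 8 (p. 16)]
-/

noncomputable section

namespace Summit.CriticalPhenomena.PercolationContinuityZ3.Theorems.Transplant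

open Literature.Probability.Percolation Literature.Probability.LatticeModels

/-! ## Signed coordinate permutations are automorphisms of distance graphs -/

/-- Signed coordinate permutations preserve squared distances: `‖σx − σy‖² = ‖x − y‖²`. [cite: ConwaySloane1999, Ch. 4 §7.1] -/
theorem sum_sq_sub_signedPerm {d : ℕ} (π : Equiv.Perm (Fin d)) (ε : Fin d → ℤˣ) (x y : Site d) :
    ∑ i, (Site.signedPerm π ε x i - Site.signedPerm π ε y i) ^ 2 = ∑ i, (x i - y i) ^ 2 := by
  have hε : ∀ i, ((ε i : ℤ)) ^ 2 = 1 := fun i => by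
    rcases Int.units_eq_one_or (ε i) with h | h <;> simp [h]
  calc ∑ i, (Site.signedPerm π ε x i - Site.signedPerm π ε y i) ^ 2
      = ∑ i, (x (π.symm i) - y (π.symm i)) ^ 2 := Finset.sum_congr rfl fun i _ => by
          rw [Site.signedPerm_apply, Site.signedPerm_apply, ← mul_sub, mul_pow, hε i, one_mul]
    _ = ∑ i, (x i - y i) ^ 2 := Equiv.sum_comp π.symm (fun i => (x i - y i) ^ 2)

/-- Signed coordinate permutations preserve adjacency in every distance graph `distSqGraph d m`. [cite: ConwaySloane1999, Ch. 4 §7.1] -/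
theorem distSqGraph_adj_signedPerm_iff {d : ℕ} {m : ℤ} (π : Equiv.Perm (Fin d)) (ε : Fin d → ℤˣ) (x y : Site d) :
    (distSqGraph d m).Adj (Site.signedPerm π ε x) (Site.signedPerm π ε y) ↔ (distSqGraph d m).Adj x y := by
  rw [distSqGraph_adj, distSqGraph_adj, sum_sq_sub_signedPerm, (Site.signedPerm π ε).injective.ne_iff]

/-- **A signed coordinate permutation preserving the vertex set `S` is an automorphism of the induced distance graph on `S`** (the point
group of a cubic crystallographic lattice). [cite: ConwaySloane1999, Ch. 4 §7.1 (automorphisms of D_n)] -/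
def distSqGraphSignedPermIso (d : ℕ) (m : ℤ) (S : Set (Site d)) (π : Equiv.Perm (Fin d)) (ε : Fin d → ℤˣ)
    (hS : ∀ x, Site.signedPerm π ε x ∈ S ↔ x ∈ S) :
    (distSqGraph d m).induce S ≃g (distSqGraph d m).induce S where
  toEquiv := (Site.signedPerm π ε).subtypeEquiv fun x => (hS x).symm
  map_rel_iff' := by
    intro a b
    exact distSqGraph_adj_signedPerm_iff π ε a b

/-- The automorphism acts by the signed permutation on coordinates. [folklore] -/
@[simp] theorem coe_distSqGraphSignedPermIso {d : ℕ} {m : ℤ} {S : Set (Site d)} (π : Equiv.Perm (Fin d)) (ε : Fin d → ℤˣ)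
    (hS : ∀ x, Site.signedPerm π ε x ∈ S ↔ x ∈ S) (x : S) :
    ((distSqGraphSignedPermIso d m S π ε hS x : S) : Site d) = Site.signedPerm π ε x := rfl

/-- Parity of the coordinate sum is invariant under signed permutations (`ε x ≡ x (mod 2)`). [folklore] -/
theorem even_sum_signedPerm_iff {d : ℕ} (π : Equiv.Perm (Fin d)) (ε : Fin d → ℤˣ) (x : Site d) :
    Even (∑ i, Site.signedPerm π ε x i) ↔ Even (∑ i, x i) := by
  have hre : ∑ i, x (π.symm i) = ∑ i, x i := Equiv.sum_comp π.symm x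
  have hdvd : (2 : ℤ) ∣ ∑ i, Site.signedPerm π ε x i - ∑ i, x i := by
    rw [← hre, ← Finset.sum_sub_distrib]
    refine Finset.dvd_sum fun i _ => ?_
    rw [Site.signedPerm_apply]
    rcases Int.units_eq_one_or (ε i) with h | h
    · simp [h]
    · rw [h]; exact ⟨-x (π.symm i), by push_cast; ring⟩
  exact Int.even_sub.1 (even_iff_two_dvd.2 hdvd)

/-- **The fcc vertex set `D₃` is invariant under the cubic point group.** [cite: ConwaySloane1999, Ch. 4 §7.1] -/
theorem signedPerm_mem_fccSite_iff (π : Equiv.Perm (Fin 3)) (ε : Fin 3 → ℤˣ) (x : Site 3) :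
    Site.signedPerm π ε x ∈ fccSite ↔ x ∈ fccSite := by
  rw [mem_fccSite_iff, mem_fccSite_iff, ← Fin.sum_univ_three (fun i => Site.signedPerm π ε x i), ← Fin.sum_univ_three (fun i => x i)]
  exact even_sum_signedPerm_iff π ε x

/-- **The bcc vertex set `2·D₃*` is invariant under the cubic point group.** [cite: ConwaySloane1999, Ch. 4 §7.1] -/
theorem signedPerm_mem_bccSite_iff (π : Equiv.Perm (Fin 3)) (ε : Fin 3 → ℤˣ) (x : Site 3) :
    Site.signedPerm π ε x ∈ bccSite ↔ x ∈ bccSite := by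
  have hev : ∀ i, Even (Site.signedPerm π ε x i) ↔ Even (x (π.symm i)) := fun i => by
    rw [Site.signedPerm_apply, Int.even_mul]
    rcases Int.units_eq_one_or (ε i) with h | h <;> simp [h]
  have hod : ∀ i, Odd (Site.signedPerm π ε x i) ↔ Odd (x (π.symm i)) := fun i => by
    rw [Site.signedPerm_apply, Int.odd_mul]
    rcases Int.units_eq_one_or (ε i) with h | h <;> simp [h]
  rw [mem_bccSite_iff, mem_bccSite_iff]
  simp only [hev, hod]
  rw [← π.symm.surjective.forall (p := fun j => Even (x j)), ← π.symm.surjective.forall (p := fun j => Odd (x j))]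

/-- **The cubic point group acts on the fcc lattice**: every signed coordinate permutation is a graph automorphism of `fccGraph` (fixing the
origin, `fccPointIso_origin`). [cite: ConwaySloane1999, Ch. 4 §7.1] -/
def fccPointIso (π : Equiv.Perm (Fin 3)) (ε : Fin 3 → ℤˣ) : fccGraph ≃g fccGraph :=
  distSqGraphSignedPermIso 3 2 fccSite π ε (signedPerm_mem_fccSite_iff π ε)

/-- **The cubic point group acts on the bcc lattice.** [cite: ConwaySloane1999, Ch. 4 §7.1] -/
def bccPointIso (π : Equiv.Perm (Fin 3)) (ε : Fin 3 → ℤˣ) : bccGraph ≃g bccGraph :=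
  distSqGraphSignedPermIso 3 3 bccSite π ε (signedPerm_mem_bccSite_iff π ε)

/-- Coordinates of the point-group action on fcc. [folklore] -/
@[simp] theorem coe_fccPointIso (π : Equiv.Perm (Fin 3)) (ε : Fin 3 → ℤˣ) (x : fccSite) :
    ((fccPointIso π ε x : fccSite) : Site 3) = Site.signedPerm π ε x := rfl

/-- Coordinates of the point-group action on bcc. [folklore] -/
@[simp] theorem coe_bccPointIso (π : Equiv.Perm (Fin 3)) (ε : Fin 3 → ℤˣ) (x : bccSite) :
    ((bccPointIso π ε x : bccSite) : Site 3) = Site.signedPerm π ε x := rfl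

/-- The point group fixes the fcc origin. [folklore] -/
@[simp] theorem fccPointIso_origin (π : Equiv.Perm (Fin 3)) (ε : Fin 3 → ℤˣ) : fccPointIso π ε fccOrigin = fccOrigin :=
  Subtype.ext (by rw [coe_fccPointIso]; exact Site.signedPerm_zero π ε)

/-- The point group fixes the bcc origin. [folklore] -/
@[simp] theorem bccPointIso_origin (π : Equiv.Perm (Fin 3)) (ε : Fin 3 → ℤˣ) : bccPointIso π ε bccOrigin = bccOrigin :=
  Subtype.ext (by rw [coe_bccPointIso]; exact Site.signedPerm_zero π ε)

/-! ## Edges move every coordinate by at most one -/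

/-- In `distSqGraph d m` with `m < 4` (fcc: `m = 2`, bcc: `m = 3`, `ℤ^d`: `m = 1`) every coordinate changes by at most `1` along an edge
(`t² ≤ Σ = m < 4` forces `|t| ≤ 1`). [folklore] -/
theorem distSqGraph_abs_sub_le_one {d : ℕ} {m : ℤ} (hm : m < 4) {x y : Site d} (h : (distSqGraph d m).Adj x y) (i : Fin d) :
    |x i - y i| ≤ 1 := by
  have hle : (x i - y i) ^ 2 ≤ ∑ j, (x j - y j) ^ 2 :=
    Finset.single_le_sum (f := fun j => (x j - y j) ^ 2) (fun j _ => sq_nonneg _) (Finset.mem_univ i)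
  rw [h.2] at hle
  by_contra hgt
  push Not at hgt
  have h2 : 2 ≤ |x i - y i| := hgt
  nlinarith [sq_abs (x i - y i), abs_nonneg (x i - y i)]

/-- **Fibre control on fcc**: the third coordinate changes by at most `1` along an fcc edge. [cite: ConwaySloane1999, Ch. 4 §7.1 (minimal vectors ±e_i±e_j)] -/
theorem fcc_abs_sub_fibre_le {x y : fccSite} (h : fccGraph.Adj x y) : |(x : Site 3) 2 - (y : Site 3) 2| ≤ 1 :=
  distSqGraph_abs_sub_le_one (by norm_num) h 2

/-- **Fibre control on bcc**: the third coordinate changes by at most `1` along a bcc edge. [cite: ConwaySloane1999, Ch. 4 §7.1] -/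
theorem bcc_abs_sub_fibre_le {x y : bccSite} (h : bccGraph.Adj x y) : |(x : Site 3) 2 - (y : Site 3) 2| ≤ 1 :=
  distSqGraph_abs_sub_le_one (by norm_num) h 2

/-! ## The fcc skeleton `φ(x) = (x₀, x₁)` -/

/-- The planar skeleton of the fcc lattice: the first two ambient coordinates, `φ(x) = (x₀, x₁) ∈ ℤ²`. [cite: KozmaNitzan2024, §4 (p. 16, the lattice ℤ² of Lemma 8)] -/
def fccSkel (x : fccSite) : Site 2 := ![(x : Site 3) 0, (x : Site 3) 1]

/-- First skeleton coordinate. [folklore] -/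
@[simp] theorem fccSkel_apply_zero (x : fccSite) : fccSkel x 0 = (x : Site 3) 0 := rfl
/-- Second skeleton coordinate. [folklore] -/
@[simp] theorem fccSkel_apply_one (x : fccSite) : fccSkel x 1 = (x : Site 3) 1 := rfl

/-- The skeleton of the origin is the origin. [folklore] -/
@[simp] theorem fccSkel_origin : fccSkel fccOrigin = 0 := by
  ext i; fin_cases i <;> rfl

/-- **The fcc skeleton is additive** (a group homomorphism `D₃ → ℤ²`). [folklore] -/
theorem fccSkel_add (x y : fccSubgroup) : fccSkel (x + y) = fccSkel x + fccSkel y := by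
  ext i; fin_cases i <;> rfl

/-- **Translation-equivariance**: the lattice translation by `v` (`distSqGraphShiftIso`, an automorphism of `fccGraph`) acts on the skeleton as the
translation of `ℤ²` by `φ(v)`. [folklore] -/
theorem fccSkel_shiftIso (v x : fccSubgroup) : fccSkel (distSqGraphShiftIso 3 2 fccSubgroup v x) = fccSkel x + fccSkel v :=
  fccSkel_add x v

/-- **Every translation of `ℤ²` is a skeleton-translation**: `φ` is surjective (`(a, b) = φ(a, b, a + b)`). [folklore] -/
theorem fccSkel_surjective : Function.Surjective fccSkel := by
  intro t
  refine ⟨⟨![t 0, t 1, t 0 + t 1], (mem_fccSite_iff _).2 ⟨t 0 + t 1, by simp⟩⟩, ?_⟩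
  ext i; fin_cases i <;> rfl

/-- **The fcc skeleton is `1`-Lipschitz for the sup-norm**: along an edge each skeleton coordinate moves by at most `1`.
[cite: ConwaySloane1999, Ch. 4 §7.1 (minimal vectors ±e_i±e_j)] -/
theorem fccSkel_lipschitz {x y : fccSite} (h : fccGraph.Adj x y) (i : Fin 2) : |fccSkel x i - fccSkel y i| ≤ 1 := by
  fin_cases i
  · exact distSqGraph_abs_sub_le_one (by norm_num) h 0
  · exact distSqGraph_abs_sub_le_one (by norm_num) h 1

/-! ## The bcc skeleton `φ(x) = ((x₀+x₁)/2, (x₀−x₁)/2)` -/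

/-- On a bcc site `x₀ + x₁` is even. [folklore] -/
theorem two_dvd_add_of_mem_bccSite (x : bccSite) : (2 : ℤ) ∣ (x : Site 3) 0 + (x : Site 3) 1 := by
  rcases (mem_bccSite_iff (x : Site 3)).1 x.2 with h | h
  · exact even_iff_two_dvd.1 ((h 0).add (h 1))
  · exact even_iff_two_dvd.1 ((h 0).add_odd (h 1))

/-- On a bcc site `x₀ − x₁` is even. [folklore] -/
theorem two_dvd_sub_of_mem_bccSite (x : bccSite) : (2 : ℤ) ∣ (x : Site 3) 0 - (x : Site 3) 1 := by
  rcases (mem_bccSite_iff (x : Site 3)).1 x.2 with h | h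
  · exact even_iff_two_dvd.1 ((h 0).sub (h 1))
  · exact even_iff_two_dvd.1 ((h 0).sub_odd (h 1))

/-- The planar skeleton of the bcc lattice in the rotated frame: `φ(x) = ((x₀+x₁)/2, (x₀−x₁)/2) ∈ ℤ²` (integral: `x₀ ≡ x₁ (mod 2)` on bcc sites).
In this frame the eight bcc steps `(±1,±1,±1)` project onto the four unit steps of `ℤ²` and every translation of `ℤ²` is realised by a lattice
translation. [cite: ConwaySloane1999, Ch. 4 §7.1] [cite: KozmaNitzan2024, §4 (p. 16)] -/
def bccSkel (x : bccSite) : Site 2 := ![((x : Site 3) 0 + (x : Site 3) 1) / 2, ((x : Site 3) 0 - (x : Site 3) 1) / 2]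

/-- First bcc skeleton coordinate, doubled: `2 φ₀(x) = x₀ + x₁`. [folklore] -/
theorem two_mul_bccSkel_zero (x : bccSite) : 2 * bccSkel x 0 = (x : Site 3) 0 + (x : Site 3) 1 :=
  Int.mul_ediv_cancel' (two_dvd_add_of_mem_bccSite x)

/-- Second bcc skeleton coordinate, doubled: `2 φ₁(x) = x₀ − x₁`. [folklore] -/
theorem two_mul_bccSkel_one (x : bccSite) : 2 * bccSkel x 1 = (x : Site 3) 0 - (x : Site 3) 1 :=
  Int.mul_ediv_cancel' (two_dvd_sub_of_mem_bccSite x)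

/-- The skeleton of the origin is the origin. [folklore] -/
@[simp] theorem bccSkel_origin : bccSkel bccOrigin = 0 := by
  ext i; fin_cases i <;> rfl

/-- **The bcc skeleton is additive** (a group homomorphism `2·D₃* → ℤ²`). [folklore] -/
theorem bccSkel_add (x y : bccSubgroup) : bccSkel (x + y) = bccSkel x + bccSkel y := by
  ext i
  fin_cases i
  · have h1 := two_mul_bccSkel_zero (x + y)
    have h2 := two_mul_bccSkel_zero x
    have h3 := two_mul_bccSkel_zero y
    simp only [AddSubgroup.coe_add, Pi.add_apply] at h1 ⊢
    change bccSkel (x + y) 0 = bccSkel x 0 + bccSkel y 0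
    omega
  · have h1 := two_mul_bccSkel_one (x + y)
    have h2 := two_mul_bccSkel_one x
    have h3 := two_mul_bccSkel_one y
    simp only [AddSubgroup.coe_add, Pi.add_apply] at h1 ⊢
    change bccSkel (x + y) 1 = bccSkel x 1 + bccSkel y 1
    omega

/-- **Translation-equivariance** of the bcc skeleton under the lattice translations `distSqGraphShiftIso`. [folklore] -/
theorem bccSkel_shiftIso (v x : bccSubgroup) : bccSkel (distSqGraphShiftIso 3 3 bccSubgroup v x) = bccSkel x + bccSkel v :=
  bccSkel_add x v

/-- **Every translation of `ℤ²` is a bcc skeleton-translation**: `φ` is surjective (`(u, v) = φ(u+v, u−v, u+v)`). [folklore] -/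
theorem bccSkel_surjective : Function.Surjective bccSkel := by
  intro t
  have hmem : (![t 0 + t 1, t 0 - t 1, t 0 + t 1] : Site 3) ∈ bccSite := by
    rw [mem_bccSite_iff]
    rcases Int.even_or_odd (t 0 + t 1) with h | h
    · refine Or.inl fun i => ?_
      fin_cases i
      · exact h
      · show Even (t 0 - t 1)
        have : t 0 - t 1 = (t 0 + t 1) - 2 * t 1 := by ring
        rw [this]; exact h.sub (even_two_mul _)
      · exact h
    · refine Or.inr fun i => ?_
      fin_cases i
      · exact h
      · show Odd (t 0 - t 1)
        have : t 0 - t 1 = (t 0 + t 1) - 2 * t 1 := by ring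
        rw [this]; exact h.sub_even (even_two_mul _)
      · exact h
  refine ⟨⟨_, hmem⟩, ?_⟩
  have h0 := two_mul_bccSkel_zero ⟨_, hmem⟩
  have h1 := two_mul_bccSkel_one ⟨_, hmem⟩
  simp only [Matrix.cons_val_zero, Matrix.cons_val_one] at h0 h1
  ext i
  fin_cases i
  · change bccSkel ⟨_, hmem⟩ 0 = t 0
    omega
  · change bccSkel ⟨_, hmem⟩ 1 = t 1
    omega

/-- **The bcc skeleton is `1`-Lipschitz for the sup-norm** along edges. [cite: ConwaySloane1999, Ch. 4 §7.1] -/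
theorem bccSkel_lipschitz {x y : bccSite} (h : bccGraph.Adj x y) (i : Fin 2) : |bccSkel x i - bccSkel y i| ≤ 1 := by
  have h0 : |(x : Site 3) 0 - (y : Site 3) 0| ≤ 1 := distSqGraph_abs_sub_le_one (show (3 : ℤ) < 4 by norm_num) h 0
  have h1 : |(x : Site 3) 1 - (y : Site 3) 1| ≤ 1 := distSqGraph_abs_sub_le_one (show (3 : ℤ) < 4 by norm_num) h 1
  rw [abs_le] at h0 h1 ⊢
  fin_cases i
  · have hx := two_mul_bccSkel_zero x
    have hy := two_mul_bccSkel_zero y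
    change -1 ≤ bccSkel x 0 - bccSkel y 0 ∧ bccSkel x 0 - bccSkel y 0 ≤ 1
    omega
  · have hx := two_mul_bccSkel_one x
    have hy := two_mul_bccSkel_one y
    change -1 ≤ bccSkel x 1 - bccSkel y 1 ∧ bccSkel x 1 - bccSkel y 1 ≤ 1
    omega

/-- Along a bcc edge all three coordinates change by exactly `±1`. [cite: ConwaySloane1999, Ch. 4 §7.1 (the eight neighbours (±1,±1,±1))] -/
theorem bcc_abs_sub_eq_one {x y : bccSite} (h : bccGraph.Adj x y) (i : Fin 3) : |(x : Site 3) i - (y : Site 3) i| = 1 := by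
  have hle : ∀ j, |(x : Site 3) j - (y : Site 3) j| ≤ 1 := fun j =>
    distSqGraph_abs_sub_le_one (show (3 : ℤ) < 4 by norm_num) h j
  have hsum : ∑ j, ((x : Site 3) j - (y : Site 3) j) ^ 2 = 3 := h.2
  rw [Fin.sum_univ_three] at hsum
  have hsq : ∀ j, ((x : Site 3) j - (y : Site 3) j) ^ 2 ≤ 1 := fun j => by
    have h1 := hle j
    rw [abs_le] at h1
    nlinarith [h1.1, h1.2]
  have e0 : ((x : Site 3) 0 - (y : Site 3) 0) ^ 2 = 1 := by linarith [hsq 0, hsq 1, hsq 2]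
  have e1 : ((x : Site 3) 1 - (y : Site 3) 1) ^ 2 = 1 := by linarith [hsq 0, hsq 1, hsq 2]
  have e2 : ((x : Site 3) 2 - (y : Site 3) 2) ^ 2 = 1 := by linarith [hsq 0, hsq 1, hsq 2]
  have hsq1 : ((x : Site 3) i - (y : Site 3) i) ^ 2 = 1 := by
    fin_cases i
    · exact e0
    · exact e1
    · exact e2
  rw [← sq_abs] at hsq1
  exact (pow_eq_one_iff_of_nonneg (abs_nonneg _) two_ne_zero).1 hsq1

/-- **The bcc skeleton is a graph homomorphism onto the square lattice**: adjacent bcc sites have skeleton images adjacent in `zdGraph 2` (exactly one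
of `(Δx₀ + Δx₁)/2`, `(Δx₀ − Δx₁)/2` is `±1`, the other `0`, when `Δx₀, Δx₁ = ±1`). [cite: ConwaySloane1999, Ch. 4 §7.1] -/
theorem zdGraph_adj_bccSkel {x y : bccSite} (h : bccGraph.Adj x y) : (zdGraph 2).Adj (bccSkel x) (bccSkel y) := by
  have h0 := bcc_abs_sub_eq_one h 0
  have h1 := bcc_abs_sub_eq_one h 1
  have hx0 := two_mul_bccSkel_zero x
  have hy0 := two_mul_bccSkel_zero y
  have hx1 := two_mul_bccSkel_one x
  have hy1 := two_mul_bccSkel_one y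
  rw [abs_eq (by norm_num : (0 : ℤ) ≤ 1)] at h0 h1
  rw [zdGraph_adj_iff]
  -- the four sign patterns
  have key : ∀ (i : Fin 2) (s t : Site 2), (∀ j, j ≠ i → t j = s j) → t i = s i + 1 → t = s + Pi.single i 1 := by
    intro i s t hne hi
    ext j
    rcases eq_or_ne j i with rfl | hj
    · simp [hi]
    · simp [Pi.single_eq_of_ne hj, hne j hj]
  rcases h0 with h0 | h0 <;> rcases h1 with h1 | h1
  · -- Δ0 = Δ1 = 1 (x - y): y = x - (1,0): x = y + e0
    refine ⟨0, Or.inr (key 0 (bccSkel y) (bccSkel x) (fun j hj => ?_) ?_)⟩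
    · fin_cases j
      · exact absurd rfl hj
      · change bccSkel x 1 = bccSkel y 1; omega
    · omega
  · refine ⟨1, Or.inr (key 1 (bccSkel y) (bccSkel x) (fun j hj => ?_) ?_)⟩
    · fin_cases j
      · change bccSkel x 0 = bccSkel y 0; omega
      · exact absurd rfl hj
    · omega
  · refine ⟨1, Or.inl (key 1 (bccSkel x) (bccSkel y) (fun j hj => ?_) ?_)⟩
    · fin_cases j
      · change bccSkel y 0 = bccSkel x 0; omega
      · exact absurd rfl hj
    · omega
  · refine ⟨0, Or.inl (key 0 (bccSkel x) (bccSkel y) (fun j hj => ?_) ?_)⟩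
    · fin_cases j
      · exact absurd rfl hj
      · change bccSkel y 1 = bccSkel x 1; omega
    · omega

end Summit.CriticalPhenomena.PercolationContinuityZ3.Theorems.Transplant
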